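import Mathlib
import HarnessLib
import Summits.Ventures.LatticeQCDFlow.Exactness.LatticeBlockSecondMomentTensorization

/-!
# The acceptance ceiling of an independence sampler on a lattice of compact sites: `acc = ∫∫e^{−max(F,F')}dπdπ/∫e^{−F}dπ ≤ (∫e^{−F/2}dπ)²/∫e^{−F}dπ` and its block tensorization `acc·exp(Σ_j e^{−2M_j}Var(A_C h_j)/(4 + M_j²)) ≤ e^{2δ}` — the generic (compact-site) form of `SphereIndependenceSamplerAcceptanceCeiling`

HONEST FRAMING: exact (Metropolis-corrected) sampling algorithms for lattice gauge theory;
figures of merit are autocorrelation/cost numbers at stated couplings and volumes; no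
continuum-physics claim.

Venture `LatticeQCDFlow` (cell pub-lqcd), topic `Exactness`; FANOUT row 7 (`s0-cpn-null`).  NEW WORK
of the cell over this lineage's `Exactness/LatticeBlockSecondMomentTensorization.lean` (the non-product tensorization of the second
moment of the weights on a finite product of compact probability spaces) and Mathlib's
`integral_tilted`; the pair inequality `∫∫e^{−max(F,F')} ≤ (∫e^{−F/2})²` of the lattice-of-spheres file
`Exactness/SphereIndependenceSamplerAcceptanceCeiling.lean` is re-derived inline; nothing is cited as a
fact.  Printed counterparts, NAMED ONLY: Albergo–Kanwar–Shanahan 2019 §II;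
the Bhattacharyya affinity [folklore]; Abbott et al. 2022 §V; the venture's barrier B1
`Scaling/Barriers.VolumeScalingOfTraining` (theory-2, finite state spaces: acceptance `≤ e^{−mδ²}` for
product priors with per-block TV defect `δ`) and row 3's product volume law
`Scaling/AcceptanceVolumeDecayPi`.  THE GENERIC FORM, FOR EVERY COMPACT-SITE LATTICE MODEL.  Sites `ι`
(finite), compact metric site space `X` with a Borel probability measure `μ`, `π = ⊗_ι μ`; a continuous
log-weight `F` on `Ω = X^ι`; the independence Metropolis sampler with target `π.tilted(−F)` and proposal
`π` (e.g. ANY exact flow sampler in flowed coordinates, `F` = its effective action).  Its mean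
acceptance at stationarity is `acc = ∫∫e^{−max(F(ω),F(ω'))}dπdπ/∫e^{−F}dπ ≤ (∫e^{−F/2}dπ)²/∫e^{−F}dπ`,
and if `F` is within `δ` of a sum of block-local terms `h_j` (pairwise disjoint dependence sets
`D_j ⊇ B_j`, oscillation `≤ M_j`) plus a corridor term off `⋃_j B_j` then, with `C = ι ∖ ⋃_j B_j`,
`acc · exp(Σ_j e^{−2M_j}·Var_π(A_C h_j)/(4 + M_j²)) ≤ e^{2δ}`: the acceptance of a fixed-receptive-field
exact sampler is at most `e^{2δ}` times a PRODUCT over blocks of factors `< 1`, on continuous compact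
configuration spaces and WITHOUT product structure of target or proposal.

## Content

* **`latticeIndep_meanAccept_eq`** — the closed form of the mean acceptance.
* **`latticeIndep_meanAccept_le_sq_integral_exp_neg_half_div`** — the Bhattacharyya ceiling.
* **`latticeIndep_meanAccept_mul_exp_blockSum_le`** — the tensorized ceiling.

NOT CLAIMED: non-compact sites; anything model-specific (instances: `SphereIndependenceSamplerAcceptanceCeiling`,
`TorusLinkAcceptanceCeiling`); numbers.
-/

noncomputable section

namespace Summit.Ventures.LatticeQCDFlow.Exactness

open Function Set Metric MeasureTheory
open scoped Topology

variable {ι : Type*} [Fintype ι] [DecidableEq ι]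
variable {X : Type*} [MeasurableSpace X] [MetricSpace X] [CompactSpace X] [BorelSpace X]
  (μ : Measure X) [IsProbabilityMeasure μ]

/-! ## §1 The closed form and the Bhattacharyya ceiling -/

omit [DecidableEq ι] [MetricSpace X] [CompactSpace X] [BorelSpace X] [IsProbabilityMeasure μ] in
/-- **THE MEAN ACCEPTANCE IN CLOSED FORM (compact sites)**: for every `F` on `Ω = X^ι`,
`∫ (∫ min(1, e^{F(ω) − F(ω')}) dπ(ω')) d(π.tilted(−F))(ω) = (∫∫ e^{−max(F(ω),F(ω'))} dπ dπ)/(∫ e^{−F} dπ)`. -/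
theorem latticeIndep_meanAccept_eq (F : (ι → X) → ℝ) :
    ∫ ω, (∫ ω', min 1 (Real.exp (F ω - F ω')) ∂Measure.pi (fun _ : ι => μ))
      ∂(Measure.pi (fun _ : ι => μ)).tilted (fun ω => -F ω) =
      (∫ ω, ∫ ω', Real.exp (-max (F ω) (F ω')) ∂Measure.pi (fun _ : ι => μ) ∂Measure.pi (fun _ : ι => μ)) /
        ∫ ω, Real.exp (-F ω) ∂Measure.pi (fun _ : ι => μ) := by
  rw [integral_tilted, ← integral_div]
  refine integral_congr_ae (ae_of_all _ fun ω => ?_)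
  simp only [smul_eq_mul]
  rw [div_mul_eq_mul_div, ← integral_const_mul]
  congr 1
  refine integral_congr_ae (ae_of_all _ fun ω' => ?_)
  simp only
  -- `e^{−F ω} · min(1, e^{F ω − F ω'}) = e^{−max(F ω, F ω')}`
  rw [mul_min_of_nonneg _ _ (Real.exp_pos _).le, mul_one, ← Real.exp_add,
    show -F ω + (F ω - F ω') = -F ω' by ring, max_def]
  split_ifs with h
  · rw [min_eq_right (Real.exp_le_exp.2 (neg_le_neg h))]
  · rw [min_eq_left (Real.exp_le_exp.2 (neg_le_neg (le_of_not_ge h)))]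

omit [DecidableEq ι] in
/-- **THE ACCEPTANCE CEILING (compact sites).**  For every continuous log-weight `F` on `Ω = X^ι`:
`acc ≤ (∫ e^{−F/2} dπ)² / ∫ e^{−F} dπ`. -/
theorem latticeIndep_meanAccept_le_sq_integral_exp_neg_half_div {F : (ι → X) → ℝ} (hF : Continuous F) :
    ∫ ω, (∫ ω', min 1 (Real.exp (F ω - F ω')) ∂Measure.pi (fun _ : ι => μ))
      ∂(Measure.pi (fun _ : ι => μ)).tilted (fun ω => -F ω) ≤
      (∫ ω, Real.exp (-(F ω / 2)) ∂Measure.pi (fun _ : ι => μ)) ^ 2 /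
        ∫ ω, Real.exp (-F ω) ∂Measure.pi (fun _ : ι => μ) := by
  set π : Measure (ι → X) := Measure.pi (fun _ : ι => μ) with hπ
  rw [latticeIndep_meanAccept_eq μ F]
  have hZpos : 0 < ∫ ω, Real.exp (-F ω) ∂π :=
    integral_exp_pos (integrable_pi_of_continuous _ (Real.continuous_exp.comp hF.neg))
  refine div_le_div_of_nonneg_right ?_ hZpos.le
  -- `∫∫ e^{−max(F,F')} ≤ (∫ e^{−F/2})²` (`max ≥ mean`, then the product integrand factorises)
  have hhc : Continuous fun ω : ι → X => Real.exp (-(F ω / 2)) := (hF.div_const 2).neg.rexp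
  have hhi : Integrable (fun ω => Real.exp (-(F ω / 2))) π := integrable_pi_of_continuous _ hhc
  have hinner : ∀ ω, ∫ ω', Real.exp (-max (F ω) (F ω')) ∂π ≤
      Real.exp (-(F ω / 2)) * ∫ ω', Real.exp (-(F ω' / 2)) ∂π := by
    intro ω
    rw [← integral_const_mul]
    refine integral_mono (integrable_pi_of_continuous _
      (Real.continuous_exp.comp (continuous_const.max hF).neg)) (hhi.const_mul _) fun ω' => ?_
    show Real.exp (-max (F ω) (F ω')) ≤ Real.exp (-(F ω / 2)) * Real.exp (-(F ω' / 2))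
    rw [← Real.exp_add]
    refine Real.exp_le_exp.2 ?_
    have h1 := le_max_left (F ω) (F ω')
    have h2 := le_max_right (F ω) (F ω')
    linarith
  have hoc : Continuous fun ω : ι → X => ∫ ω', Real.exp (-max (F ω) (F ω')) ∂π := by
    have hf : Continuous (uncurry fun (ω : ι → X) (ω' : ι → X) => Real.exp (-max (F ω) (F ω'))) :=
      Real.continuous_exp.comp ((hF.comp continuous_fst).max (hF.comp continuous_snd)).neg
    have h := continuous_parametric_integral_of_continuous (μ := π) hf isCompact_univ
    simp only [Measure.restrict_univ] at h
    exact h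
  calc ∫ ω, ∫ ω', Real.exp (-max (F ω) (F ω')) ∂π ∂π
      ≤ ∫ ω, Real.exp (-(F ω / 2)) * ∫ ω', Real.exp (-(F ω' / 2)) ∂π ∂π :=
        integral_mono (integrable_pi_of_continuous _ hoc) (hhi.mul_const _) hinner
    _ = (∫ ω, Real.exp (-(F ω / 2)) ∂π) ^ 2 := by rw [integral_mul_const, sq]

/-! ## §2 The tensorized acceptance ceiling -/

/-- **THE TENSORIZED ACCEPTANCE CEILING (compact sites).**  Blocks `B_j ⊆ D_j` with the `D_j` pairwise
disjoint (`j ∈ T`); `h_j` continuous, depending on `D_j`, with oscillation `≤ M_j` (`0 ≤ M_j`); `r`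
continuous depending on the complement of `⋃_j B_j`; `C = ι ∖ ⋃_j B_j`; a continuous log-weight `F`
with `|F − (Σ_j h_j + r)| ≤ δ` on `Ω`.  Then
`acc · exp(Σ_j e^{−2M_j}·∫(A_C h_j − ∫h_j)²dπ/(4 + M_j²)) ≤ e^{2δ}`. -/
theorem latticeIndep_meanAccept_mul_exp_blockSum_le {J : Type*} (T : Finset J) (B D : J → Finset ι)
    (hBD : ∀ j ∈ T, B j ⊆ D j) (hD : ∀ j ∈ T, ∀ j' ∈ T, j ≠ j' → Disjoint (D j) (D j'))
    {h : J → (ι → X) → ℝ} (hc : ∀ j ∈ T, Continuous (h j))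
    (hdep : ∀ j ∈ T, DependsOn (h j) ↑(D j))
    {M : J → ℝ} (hM0 : ∀ j ∈ T, 0 ≤ M j) (hM : ∀ j ∈ T, ∀ ω ω', |h j ω - h j ω'| ≤ M j)
    {r : (ι → X) → ℝ} (hr : Continuous r) (hrdep : DependsOn r (↑(T.biUnion B) : Set ι)ᶜ)
    {F : (ι → X) → ℝ} (hF : Continuous F) {δ : ℝ}
    (hδ : ∀ ω, |F ω - (∑ j ∈ T, h j ω + r ω)| ≤ δ) :
    (∫ ω, (∫ ω', min 1 (Real.exp (F ω - F ω')) ∂Measure.pi (fun _ : ι => μ))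
      ∂(Measure.pi (fun _ : ι => μ)).tilted (fun ω => -F ω)) *
      Real.exp (∑ j ∈ T, Real.exp (-2 * M j) *
        (∫ ω, (coordAvg μ (Finset.univ \ T.biUnion B) (h j) ω -
            ∫ ω', h j ω' ∂Measure.pi (fun _ : ι => μ)) ^ 2 ∂Measure.pi (fun _ : ι => μ)) / (4 + M j ^ 2)) ≤
      Real.exp (2 * δ) := by
  set π : Measure (ι → X) := Measure.pi (fun _ : ι => μ) with hπ
  -- the half data
  set h' : J → (ι → X) → ℝ := fun j ω => (1 / 2) * h j ω with hh'
  set r' : (ι → X) → ℝ := fun ω => (1 / 2) * r ω with hr'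
  set F' : (ι → X) → ℝ := fun ω => (1 / 2) * F ω with hF'
  have hc' : ∀ j ∈ T, Continuous (h' j) := fun j hj => continuous_const.mul (hc j hj)
  have hdep' : ∀ j ∈ T, DependsOn (h' j) ↑(D j) := fun j hj ω ω' hag => by
    show (1 / 2) * h j ω = (1 / 2) * h j ω'
    rw [hdep j hj hag]
  have hM0' : ∀ j ∈ T, 0 ≤ M j / 2 := fun j hj => by linarith [hM0 j hj]
  have hM' : ∀ j ∈ T, ∀ ω ω', |h' j ω - h' j ω'| ≤ M j / 2 := by
    intro j hj ω ω'
    show |(1 / 2) * h j ω - (1 / 2) * h j ω'| ≤ M j / 2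
    rw [← mul_sub, abs_mul, abs_of_pos (by norm_num : (0 : ℝ) < 1 / 2)]
    linarith [hM j hj ω ω']
  have hr'c : Continuous r' := continuous_const.mul hr
  have hr'dep : DependsOn r' (↑(T.biUnion B) : Set ι)ᶜ := fun ω ω' hag => by
    show (1 / 2) * r ω = (1 / 2) * r ω'
    rw [hrdep hag]
  have hF'c : Continuous F' := continuous_const.mul hF
  have hδ' : ∀ ω, |F' ω - (∑ j ∈ T, h' j ω + r' ω)| ≤ δ / 2 := by
    intro ω
    have e : F' ω - (∑ j ∈ T, h' j ω + r' ω) = (1 / 2) * (F ω - (∑ j ∈ T, h j ω + r ω)) := by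
      simp only [hF', hh', hr']
      rw [← Finset.mul_sum]
      ring
    rw [e, abs_mul, abs_of_pos (by norm_num : (0 : ℝ) < 1 / 2)]
    linarith [hδ ω]
  have hmain := sq_integral_exp_neg_mul_exp_le_of_abs_sub_le μ T B D hBD hD hc' hdep' hM0' hM'
    hr'c hr'dep hF'c hδ'
  -- identify the pieces
  have hA : ∀ j ∈ T, ∀ ω, coordAvg μ (Finset.univ \ T.biUnion B) (h' j) ω =
      (1 / 2) * coordAvg μ (Finset.univ \ T.biUnion B) (h j) ω := fun j _ ω =>
    coordAvg_mul_left μ (Finset.univ \ T.biUnion B) (Φ := fun _ => (1 / 2 : ℝ)) (fun _ _ => rfl) ω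
  have hI : ∀ j ∈ T, ∫ ω', h' j ω' ∂π = (1 / 2) * ∫ ω', h j ω' ∂π := fun j _ => integral_const_mul _ _
  have hV : ∀ j ∈ T, ∫ ω, (coordAvg μ (Finset.univ \ T.biUnion B) (h' j) ω - ∫ ω', h' j ω' ∂π) ^ 2 ∂π =
      (1 / 4) * ∫ ω, (coordAvg μ (Finset.univ \ T.biUnion B) (h j) ω - ∫ ω', h j ω' ∂π) ^ 2 ∂π := by
    intro j hj
    rw [← integral_const_mul]
    refine integral_congr_ae (ae_of_all _ fun ω => ?_)
    show (coordAvg μ (Finset.univ \ T.biUnion B) (h' j) ω - ∫ ω', h' j ω' ∂π) ^ 2 =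
      (1 / 4) * (coordAvg μ (Finset.univ \ T.biUnion B) (h j) ω - ∫ ω', h j ω' ∂π) ^ 2
    rw [hA j hj ω, hI j hj]
    ring
  have hS : ∑ j ∈ T, Real.exp (-4 * (M j / 2)) *
        (∫ ω, (coordAvg μ (Finset.univ \ T.biUnion B) (h' j) ω - ∫ ω', h' j ω' ∂π) ^ 2 ∂π) /
          (1 + (M j / 2) ^ 2) =
      ∑ j ∈ T, Real.exp (-2 * M j) *
        (∫ ω, (coordAvg μ (Finset.univ \ T.biUnion B) (h j) ω - ∫ ω', h j ω' ∂π) ^ 2 ∂π) / (4 + M j ^ 2) := by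
    refine Finset.sum_congr rfl fun j hj => ?_
    rw [hV j hj, show -4 * (M j / 2) = -2 * M j by ring]
    have h4 : (4 : ℝ) + M j ^ 2 ≠ 0 := by positivity
    have h1 : (1 : ℝ) + (M j / 2) ^ 2 ≠ 0 := by positivity
    field_simp
    ring
  have e1 : ∫ ω, Real.exp (-F' ω) ∂π = ∫ ω, Real.exp (-(F ω / 2)) ∂π := by
    refine integral_congr_ae (ae_of_all _ fun ω => ?_)
    show Real.exp (-((1 / 2) * F ω)) = Real.exp (-(F ω / 2))
    congr 1; ring
  have e2 : ∫ ω, Real.exp (-2 * F' ω) ∂π = ∫ ω, Real.exp (-F ω) ∂π := by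
    refine integral_congr_ae (ae_of_all _ fun ω => ?_)
    show Real.exp (-2 * ((1 / 2) * F ω)) = Real.exp (-F ω)
    congr 1; ring
  rw [hS, e1, e2, show 4 * (δ / 2) = 2 * δ by ring] at hmain
  have hZpos : 0 < ∫ ω, Real.exp (-F ω) ∂π :=
    integral_exp_pos (integrable_pi_of_continuous _ (Real.continuous_exp.comp hF.neg))
  have hacc := latticeIndep_meanAccept_le_sq_integral_exp_neg_half_div μ hF
  have hX0 : 0 ≤ Real.exp (∑ j ∈ T, Real.exp (-2 * M j) *
      (∫ ω, (coordAvg μ (Finset.univ \ T.biUnion B) (h j) ω - ∫ ω', h j ω' ∂π) ^ 2 ∂π) / (4 + M j ^ 2)) :=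
    (Real.exp_pos _).le
  calc (∫ ω, (∫ ω', min 1 (Real.exp (F ω - F ω')) ∂π) ∂π.tilted (fun ω => -F ω)) *
        Real.exp (∑ j ∈ T, Real.exp (-2 * M j) *
          (∫ ω, (coordAvg μ (Finset.univ \ T.biUnion B) (h j) ω - ∫ ω', h j ω' ∂π) ^ 2 ∂π) / (4 + M j ^ 2))
      ≤ (∫ ω, Real.exp (-(F ω / 2)) ∂π) ^ 2 / (∫ ω, Real.exp (-F ω) ∂π) *
          Real.exp (∑ j ∈ T, Real.exp (-2 * M j) *
            (∫ ω, (coordAvg μ (Finset.univ \ T.biUnion B) (h j) ω - ∫ ω', h j ω' ∂π) ^ 2 ∂π) / (4 + M j ^ 2)) :=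
        mul_le_mul_of_nonneg_right hacc hX0
    _ = (∫ ω, Real.exp (-(F ω / 2)) ∂π) ^ 2 *
          Real.exp (∑ j ∈ T, Real.exp (-2 * M j) *
            (∫ ω, (coordAvg μ (Finset.univ \ T.biUnion B) (h j) ω - ∫ ω', h j ω' ∂π) ^ 2 ∂π) / (4 + M j ^ 2)) /
          ∫ ω, Real.exp (-F ω) ∂π := by ring
    _ ≤ Real.exp (2 * δ) * (∫ ω, Real.exp (-F ω) ∂π) / ∫ ω, Real.exp (-F ω) ∂π :=
        div_le_div_of_nonneg_right hmain hZpos.le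
    _ = Real.exp (2 * δ) := by field_simp

end Summit.Ventures.LatticeQCDFlow.Exactness

end
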